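import Summits.BirchSwinnertonDyer.BirchSwinnertonDyer.Theorems.KolyvaginRoadThreeSchneiderTamAtThreeHeightLogNumeratorScale
import Summits.BirchSwinnertonDyer.BirchSwinnertonDyer.Theorems.ClassRecordThreeRegCertKernelO2Height
import HarnessLib

/-!
# Crux `SchneiderTamAtThree` (item 19154) — THE HEIGHT IS THE LOGARITHM OF THE NUMERATOR, SECOND ORDER,
# part 1/3: series and scale lemmas one order deeper

HONEST FRAMING (cell `bsd-stepL`, seat `bsd-stepL-tam3-p2` g2, WIDTH-LEVER second lane «closed-form Schneider
local factor at 3 … finite case table proved once»; `--supports stmt-BirchSwinnertonDyer-19154 --as helper`):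
THEOREMS ONLY, unconditional, route-independent (no Theses import); 0 definitions, 0 named facts, 0 sorry;
nothing here proves the crux `SchneiderTamAtThree`, Schneider's conjecture or BSD. This file carries the
bookkeeping lemmas for the SECOND-ORDER numerator law (part 2, `…SecondOrder.lean`):
`x(P)·Σ²_E(P) ≡ 1 − (b₂b₄/c₄)·x(P)⁻¹ (mod 3^{2k+1})`, `3^{2k} ‖ den x(P)`.

* §1 `norm_two_mul_coshOfSq_sub_cubic_le` — `‖2(ch w − 1) − w − w²/12 − w³/360‖₃ ≤ 9‖w‖₃⁴` on `‖w‖₃ ≤ 3⁻²`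
  (lane A's `KernelCert.norm_coshOfSq_sub_cubic_le`, reused).
* §2 `norm_pow_three_div_sq_sub_cubic_le` — the Weierstrass equation to third order on `E₁`:
  `‖x³/y² − 1 − a₁x/y + a₂x²/y²‖₃ ≤ ‖y‖₃⁻¹` (`= ‖z‖³`), i.e. `x z² = 1 − a₁z − a₂z² + O(z³)`.
* §3 the uniformisation scale `C² = uniformisationScaleSq W 3 q = c₆(E_q)c₄(W)/(c₄(E_q)c₆(W))` one digit deeper:
  `norm_one_sub_b₂_mul_scaleSq_le` (`b₂C² ≡ 1 mod 3`, a reformulation of part 2 of the first-order chain),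
  `norm_inv_scaleSq_sub_b₂_le` (`C⁻² ≡ b₂ mod 3`) and the SECOND-ORDER TABLE
  `norm_inv_scaleSq_sub_b₂_add_le`: **`‖C⁻² − b₂ + 12·b₂b₄/c₄‖₃ ≤ 3⁻²`**, i.e. the `z²`-coefficient
  `κ = (C⁻² − b₂)/12` of `x·Σ²` satisfies `κ ≡ −b₂b₄/c₄ (mod 3)` (`norm_kappa_add_le`). Mechanism:
  `c₄(E_q) ≡ 1 (mod 9)`, `c₆(E_q) ≡ −1 (mod 27)` for `‖q‖₃ ≤ 3⁻¹`, and the integer identity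
  `c₆ + b₂c₄ − 12b₂b₄ = −216 b₆`.

References: [SteinWuthrich2013] §4.2; [SilvermanAEC2009] III.1, IV.1, VII.2; [SilvermanATAEC1994] V.3.1;
tree: parts 1–2 of the first-order chain (`…HeightLogNumeratorSeries`, `…HeightLogNumeratorScale`).
-/

noncomputable section

open scoped Classical Nat
open Filter Topology IsUltrametricDist PowerSeries
open WeierstrassCurve Literature.NumberTheory.EllipticCurves
open Literature.NumberTheory.EllipticCurves.SteinWuthrich2013
open Literature.NumberTheory.EllipticCurves.TateCurve
open Literature.NumberTheory.EllipticCurves.Rank1Residual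
open Summit.BirchSwinnertonDyer.Uniform.UI.O2

namespace Summit.BirchSwinnertonDyer.Rank1Residual.X11b.RegMult.HeightLogNumerator

/-! ### §1 The `cosh` series to third order: `‖2(ch w − 1) − w − w²/12 − w³/360‖ ≤ 9‖w‖⁴` -/

/-- **`‖2(ch(w) − 1) − w − w²/12 − w³/360‖₃ ≤ 9‖w‖⁴` for `‖w‖₃ ≤ 3⁻²`** (`‖2‖₃ = 1`): the `cosh` series of
the transcription `Σ² = C²·2(ch L − 1)·Π` to THIRD order — one order deeper than part 1's
`norm_two_mul_coshOfSq_sub_one_sub_sub_le`; the cubic term `L³/360` is visible in `x·Σ²` at the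
second `3`-adic digit when `v₃(z(P)) = 1`. From lane A's `KernelCert.norm_coshOfSq_sub_cubic_le`
(the quartic term has `‖1/8!‖₃ = 9`, the quintic `‖1/10!‖₃ = 81`, the rest by Legendre). [folklore] -/
theorem norm_two_mul_coshOfSq_sub_cubic_le {w : ℚ_[3]} (hw : ‖w‖ ≤ 1 / 9) :
    ‖2 * (coshOfSq w - 1) - w - w ^ 2 / 12 - w ^ 3 / 360‖ ≤ 9 * ‖w‖ ^ 4 := by
  have h2 : ‖(2 : ℚ_[3])‖ = 1 := by
    simpa using Padic.norm_natCast_eq_one_iff.mpr (show Nat.Coprime 3 2 by decide)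
  have e : 2 * (coshOfSq w - 1) - w - w ^ 2 / 12 - w ^ 3 / 360 =
      2 * (coshOfSq w - (1 + w / 2 + w ^ 2 / 24 + w ^ 3 / 720)) := by ring
  rw [e, norm_mul, h2, one_mul]
  exact KernelCert.norm_coshOfSq_sub_cubic_le hw

/-! ### §2 The equation to third order: `x³/y² = 1 + a₁x/y − a₂x²/y² + O(‖y‖⁻¹)` on `E₁` -/

/-- **`‖x³/y² − 1 − a₁·x/y + a₂·x²/y²‖ ≤ ‖y‖⁻¹` for a point `(x, y)` with `‖x‖ > 1` of a `3`-integral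
Weierstrass equation** (`x³ − y² − a₁xy + a₂x² = a₃y − a₄x − a₆`, each term of norm `≤ ‖y‖`): in the
parameter `z = −x/y` this is `x z² = 1 − a₁z − a₂z² + O(z³)` (`‖y‖⁻¹ = ‖z‖³`), the third-order form of
part 1's `norm_pow_three_div_sq_sub_le`. [cite: SilvermanAEC2009, IV.1 and VII.2.2] -/
theorem norm_pow_three_div_sq_sub_cubic_le {V : WeierstrassCurve ℚ_[3]} [V.IsIntegral ℤ_[3]] {x y : ℚ_[3]}
    (heq : V.toAffine.Equation x y) (hx : 1 < ‖x‖) :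
    ‖x ^ 3 / y ^ 2 - 1 - V.a₁ * (x / y) + V.a₂ * (x / y) ^ 2‖ ≤ ‖y‖⁻¹ := by
  obtain ⟨h₁, h₂, h₃, h₄, h₆⟩ := V.norm_coeffs_le_one
  obtain ⟨hsq, hxy⟩ := V.norm_sq_eq_norm_cube heq hx
  rw [Affine.equation_iff] at heq
  have hx0 : 0 < ‖x‖ := one_pos.trans hx
  have hy1 : 1 < ‖y‖ := hx.trans hxy
  have hy0 : 0 < ‖y‖ := one_pos.trans hy1
  have hy0' : y ≠ 0 := norm_pos_iff.mp hy0
  have hy2 : y ^ 2 ≠ 0 := pow_ne_zero 2 hy0'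
  have hnum : x ^ 3 - y ^ 2 - V.a₁ * x * y + V.a₂ * x ^ 2 = V.a₃ * y + (-(V.a₄ * x) + -V.a₆) := by
    linear_combination -heq
  have e : x ^ 3 / y ^ 2 - 1 - V.a₁ * (x / y) + V.a₂ * (x / y) ^ 2 =
      (V.a₃ * y + (-(V.a₄ * x) + -V.a₆)) / y ^ 2 := by
    rw [← hnum, eq_div_iff hy2]
    field_simp
  rw [e, norm_div, norm_pow, div_le_iff₀ (pow_pos hy0 2)]
  have hrhs : ‖y‖⁻¹ * ‖y‖ ^ 2 = ‖y‖ := by field_simp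
  rw [hrhs]
  refine (norm_add_le_max _ _).trans (max_le ?_ ((norm_add_le_max _ _).trans (max_le ?_ ?_)))
  · rw [norm_mul]
    calc ‖V.a₃‖ * ‖y‖ ≤ 1 * ‖y‖ := by gcongr
      _ = ‖y‖ := one_mul _
  · rw [norm_neg, norm_mul]
    calc ‖V.a₄‖ * ‖x‖ ≤ 1 * ‖x‖ := by gcongr
      _ = ‖x‖ := one_mul _
      _ ≤ ‖y‖ := hxy.le
  · rw [norm_neg]
    exact h₆.trans hy1.le

/-! ### §3 The scale one digit deeper: `C⁻² ≡ b₂ (mod 3)`, `C⁻² − b₂ ≡ −12·b₂b₄/c₄ (mod 9)` -/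

section Scale

variable {W : WeierstrassCurve ℚ}

/-- `‖b₂‖, ‖b₄‖, ‖b₆‖ ≤ 1` in `ℚ₃` for a globally minimal `W/ℚ` (copy of part 2's private lemma). [folklore] -/
private theorem norm_b_le_one' [W.IsGloballyMinimal] :
    ‖(W.baseChange ℚ_[3]).b₂‖ ≤ 1 ∧ ‖(W.baseChange ℚ_[3]).b₄‖ ≤ 1 ∧ ‖(W.baseChange ℚ_[3]).b₆‖ ≤ 1 := by
  set V := W.baseChange ℚ_[3]
  have h := V.eq_map_integralModel
  refine ⟨?_, ?_, ?_⟩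
  · have e := congrArg WeierstrassCurve.b₂ h
    rw [map_b₂] at e
    rw [← e]; exact PadicInt.norm_le_one _
  · have e := congrArg WeierstrassCurve.b₄ h
    rw [map_b₄] at e
    rw [← e]; exact PadicInt.norm_le_one _
  · have e := congrArg WeierstrassCurve.b₆ h
    rw [map_b₆] at e
    rw [← e]; exact PadicInt.norm_le_one _

/-- `‖c₄(W)‖₃ = ‖c₆(W)‖₃ = 1` at a multiplicative `3`, read on `W.baseChange ℚ₃`.
[cite: SilvermanAEC2009, VII.5.1] -/
theorem norm_c₄_c₆_baseChange_eq_one [W.IsElliptic] [W.IsGloballyMinimal] (hW : Mult W 3) :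
    ‖(W.baseChange ℚ_[3]).c₄‖ = 1 ∧ ‖(W.baseChange ℚ_[3]).c₆‖ = 1 := by
  constructor
  · have := norm_c₄_eq_one_of_hasMultiplicativeReductionAtPrime (W := W) (p := 3) hW
    rwa [show (W.c₄ : ℚ_[3]) = (W.baseChange ℚ_[3]).c₄ from
      ((map_c₄ W (algebraMap ℚ ℚ_[3])).trans (eq_ratCast _ _)).symm] at this
  · have := norm_c₆_eq_one_of_mult (W := W) (p := 3) hW
    rwa [show (W.c₆ : ℚ_[3]) = (W.baseChange ℚ_[3]).c₆ from
      ((map_c₆ W (algebraMap ℚ ℚ_[3])).trans (eq_ratCast _ _)).symm] at this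

/-- **`‖1 − b₂·C²‖₃ ≤ 3⁻¹`** (`b₂C² ≡ 1 mod 3`) at a multiplicative `3`: a reformulation of part 2's
`‖8(a₁² + a₂)C² + 1‖ ≤ 3⁻¹`, since `8(a₁² + a₂) + b₂ = 9a₁² + 12a₂`.
[cite: SteinWuthrich2013, §4.2 (p. 15)] [cite: SilvermanATAEC1994, Thm. V.3.1 (b)] -/
theorem norm_one_sub_b₂_mul_scaleSq_le [W.IsElliptic] [W.IsGloballyMinimal] (hW : Mult W 3)
    {q : ℚ_[3]} (hq : ‖q‖ < 1) :
    ‖1 - (W.baseChange ℚ_[3]).b₂ * uniformisationScaleSq W 3 q‖ ≤ 1 / 3 := by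
  set V := W.baseChange ℚ_[3]
  set C2 := uniformisationScaleSq W 3 q
  obtain ⟨ha1, ha2, -, -, -⟩ := V.norm_coeffs_le_one
  have hC : ‖C2‖ = 1 := norm_uniformisationScaleSq_eq_one hW hq
  have hS := norm_eight_mul_scaleSq_add_one_le hW hq
  have hb2 : V.b₂ = V.a₁ ^ 2 + 4 * V.a₂ := rfl
  have e : 1 - V.b₂ * C2 = (8 * (V.a₁ ^ 2 + V.a₂) * C2 + 1) - 3 * ((3 * V.a₁ ^ 2 + 4 * V.a₂) * C2) := by
    rw [hb2]; ring
  rw [e]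
  refine (norm_sub_le_max₃ _ _).trans (max_le hS ?_)
  rw [norm_mul, show (3 : ℚ_[3]) = ((3 : ℕ) : ℚ_[3]) by norm_cast, Padic.norm_p, norm_mul, hC, mul_one]
  have h4 : ‖(4 : ℚ_[3])‖ ≤ 1 := by
    have h : ((4 : ℤ) : ℚ_[3]) = 4 := by norm_cast
    rw [← h]; exact Padic.norm_int_le_one 4
  have h3' : ‖(3 : ℚ_[3])‖ ≤ 1 := by
    have h : ((3 : ℤ) : ℚ_[3]) = 3 := by norm_cast
    rw [← h]; exact Padic.norm_int_le_one 3
  have hin : ‖3 * V.a₁ ^ 2 + 4 * V.a₂‖ ≤ 1 := by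
    refine (norm_add_le_max _ _).trans (max_le ?_ ?_)
    · rw [norm_mul, norm_pow]
      calc ‖(3 : ℚ_[3])‖ * ‖V.a₁‖ ^ 2 ≤ 1 * 1 ^ 2 := by gcongr
        _ = 1 := by norm_num
    · rw [norm_mul]
      calc ‖(4 : ℚ_[3])‖ * ‖V.a₂‖ ≤ 1 * 1 := by gcongr
        _ = 1 := by norm_num
  calc (↑(3 : ℕ) : ℝ)⁻¹ * ‖3 * V.a₁ ^ 2 + 4 * V.a₂‖ ≤ (↑(3 : ℕ) : ℝ)⁻¹ * 1 := by gcongr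
    _ = 1 / 3 := by norm_num

/-- **`‖C⁻² − b₂‖₃ ≤ 3⁻¹`** (`C⁻² ≡ b₂ mod 3`): `C⁻² − b₂ = C⁻²·(1 − b₂C²)` with `‖C²‖ = 1`.
[cite: SteinWuthrich2013, §4.2 (p. 15)] -/
theorem norm_inv_scaleSq_sub_b₂_le [W.IsElliptic] [W.IsGloballyMinimal] (hW : Mult W 3)
    {q : ℚ_[3]} (hq : ‖q‖ < 1) :
    ‖(uniformisationScaleSq W 3 q)⁻¹ - (W.baseChange ℚ_[3]).b₂‖ ≤ 1 / 3 := by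
  set C2 := uniformisationScaleSq W 3 q
  have hC : ‖C2‖ = 1 := norm_uniformisationScaleSq_eq_one hW hq
  have hC0 : C2 ≠ 0 := norm_pos_iff.mp (by rw [hC]; exact one_pos)
  have e : C2⁻¹ - (W.baseChange ℚ_[3]).b₂ = C2⁻¹ * (1 - (W.baseChange ℚ_[3]).b₂ * C2) := by
    field_simp
  rw [e, norm_mul, norm_inv, hC, inv_one, one_mul]
  exact norm_one_sub_b₂_mul_scaleSq_le hW hq

/-- **THE SECOND-ORDER TABLE `‖C⁻² − b₂ + 12·b₂b₄/c₄‖₃ ≤ 3⁻²`** at a multiplicative `3` (`‖q‖₃ < 1`):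
with `C² = c₆(E_q)c₄(W)/(c₄(E_q)c₆(W))`, `c₄(E_q) = 1 + 240·s₃(q) ≡ 1 (mod 9)` and
`c₆(E_q) = −(1 − 504·s₅(q)) ≡ −1 (mod 27)`, the numerator of `C⁻² − b₂ + 12b₂b₄/c₄` over
`c₆(E_q)c₄(W)` is `≡ c₆ + b₂c₄ − 12b₂b₄ = −216·b₆ ≡ 0 (mod 27)` (`c₄ = b₂² − 24b₄`,
`c₆ = −b₂³ + 36b₂b₄ − 216b₆`). Consequence: the `z²`-coefficient `κ = (C⁻² − b₂)/12` of `x·Σ²_E` is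
`≡ −b₂b₄/c₄ (mod 3)` — the finite case table of the second `3`-adic digit of the height.
[cite: SilvermanATAEC1994, Thm. V.3.1 (b)] [cite: SilvermanAEC2009, III.1] -/
theorem norm_inv_scaleSq_sub_b₂_add_le [W.IsElliptic] [W.IsGloballyMinimal] (hW : Mult W 3)
    {q : ℚ_[3]} (hq : ‖q‖ < 1) :
    ‖(uniformisationScaleSq W 3 q)⁻¹ - (W.baseChange ℚ_[3]).b₂ +
        12 * (W.baseChange ℚ_[3]).b₂ * (W.baseChange ℚ_[3]).b₄ / (W.baseChange ℚ_[3]).c₄‖ ≤ 1 / 9 := by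
  set V := W.baseChange ℚ_[3] with hVdef
  obtain ⟨hb2, hb4, hb6⟩ := norm_b_le_one' (W := W)
  obtain ⟨hc4W, hc6W⟩ := norm_c₄_c₆_baseChange_eq_one (W := W) hW
  have h12 : (12 : ℚ_[3]) ≠ 0 := by norm_num
  have hq1 : ‖q‖ ≤ 1 := hq.le
  have hq3 : ‖q‖ ≤ 1 / 3 := by
    have := norm_le_inv_of_norm_lt_one hq
    simpa using this
  have hc4q : (tateCurve q).c₄ = 1 + 240 * tateS 3 q := by rw [tateCurve_c₄, tateE4_eq]
  have hc6q : (tateCurve q).c₆ = -(1 - 504 * tateS 5 q) := by rw [tateCurve_c₆ h12, tateE6]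
  have hS3 : ‖tateS 3 q‖ ≤ 1 / 3 := (norm_tateS_le hq1).trans hq3
  have hS5 : ‖tateS 5 q‖ ≤ 1 / 3 := (norm_tateS_le hq1).trans hq3
  have h3n : ‖(3 : ℚ_[3])‖ = 1 / 3 := by
    rw [show (3 : ℚ_[3]) = ((3 : ℕ) : ℚ_[3]) by norm_cast, Padic.norm_p]; norm_num
  have h240 : ‖(240 : ℚ_[3])‖ ≤ 1 / 3 := by
    rw [show (240 : ℚ_[3]) = ((80 : ℤ) : ℚ_[3]) * 3 by norm_num, norm_mul, h3n]
    calc ‖((80 : ℤ) : ℚ_[3])‖ * (1 / 3) ≤ 1 * (1 / 3) := by gcongr; exact Padic.norm_int_le_one 80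
      _ = 1 / 3 := one_mul _
  have h504 : ‖(504 : ℚ_[3])‖ ≤ 1 / 9 := by
    rw [show (504 : ℚ_[3]) = ((56 : ℤ) : ℚ_[3]) * (3 * 3) by norm_num, norm_mul, norm_mul, h3n]
    calc ‖((56 : ℤ) : ℚ_[3])‖ * (1 / 3 * (1 / 3)) ≤ 1 * (1 / 3 * (1 / 3)) := by
          gcongr; exact Padic.norm_int_le_one 56
      _ = 1 / 9 := by norm_num
  have h216 : ‖(216 : ℚ_[3])‖ ≤ 1 / 27 := by
    rw [show (216 : ℚ_[3]) = ((8 : ℤ) : ℚ_[3]) * (3 * 3 * 3) by norm_num, norm_mul, norm_mul, norm_mul,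
      h3n]
    calc ‖((8 : ℤ) : ℚ_[3])‖ * (1 / 3 * (1 / 3) * (1 / 3)) ≤ 1 * (1 / 3 * (1 / 3) * (1 / 3)) := by
          gcongr; exact Padic.norm_int_le_one 8
      _ = 1 / 27 := by norm_num
  -- `A := c₆(E_q) + 1` (norm ≤ 1/27), `B := c₄(E_q) − 1` (norm ≤ 1/9)
  set A : ℚ_[3] := (tateCurve q).c₆ + 1 with hAdef
  set B : ℚ_[3] := (tateCurve q).c₄ - 1 with hBdef
  have hA : ‖A‖ ≤ 1 / 27 := by
    rw [hAdef, hc6q, show -(1 - 504 * tateS 5 q) + 1 = 504 * tateS 5 q by ring, norm_mul]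
    calc ‖(504 : ℚ_[3])‖ * ‖tateS 5 q‖ ≤ (1 / 9) * (1 / 3) := by gcongr
      _ = 1 / 27 := by norm_num
  have hB : ‖B‖ ≤ 1 / 9 := by
    rw [hBdef, hc4q, show 1 + 240 * tateS 3 q - 1 = 240 * tateS 3 q by ring, norm_mul]
    calc ‖(240 : ℚ_[3])‖ * ‖tateS 3 q‖ ≤ (1 / 3) * (1 / 3) := by gcongr
      _ = 1 / 9 := by norm_num
  have hc6q1 : ‖(tateCurve q).c₆‖ = 1 := norm_c₆_tateCurve_eq_one hq
  -- the denominator `c₆(E_q)·c₄(W)` of `C⁻²`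
  have hden : ‖(tateCurve q).c₆ * V.c₄‖ = 1 := by rw [norm_mul, hc6q1, hc4W, one_mul]
  have hden0 : (tateCurve q).c₆ * V.c₄ ≠ 0 := norm_pos_iff.mp (by rw [hden]; exact one_pos)
  have hc4W0 : V.c₄ ≠ 0 := norm_pos_iff.mp (by rw [hc4W]; exact one_pos)
  have hc6q0 : (tateCurve q).c₆ ≠ 0 := norm_pos_iff.mp (by rw [hc6q1]; exact one_pos)
  have hc4b : V.c₄ = V.b₂ ^ 2 - 24 * V.b₄ := rfl
  have hc6b : V.c₆ = -V.b₂ ^ 3 + 36 * V.b₂ * V.b₄ - 216 * V.b₆ := rfl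
  have hCdef : uniformisationScaleSq W 3 q = (tateCurve q).c₆ * V.c₄ / ((tateCurve q).c₄ * V.c₆) := rfl
  -- `C⁻² − b₂ + 12 b₂ b₄ / c₄ = N / (c₆(E_q) c₄(W))`
  have e : (uniformisationScaleSq W 3 q)⁻¹ - V.b₂ + 12 * V.b₂ * V.b₄ / V.c₄ =
      ((tateCurve q).c₄ * V.c₆ - V.b₂ * (tateCurve q).c₆ * V.c₄ + 12 * V.b₂ * V.b₄ * (tateCurve q).c₆) /
        ((tateCurve q).c₆ * V.c₄) := by
    rw [hCdef, inv_div, eq_div_iff hden0]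
    field_simp
  rw [e, norm_div, hden, div_one]
  -- `N = −216 b₆ + B·c₆(W) − A·b₂·c₄(W) + 12 b₂ b₄ A`
  have e2 : (tateCurve q).c₄ * V.c₆ - V.b₂ * (tateCurve q).c₆ * V.c₄ + 12 * V.b₂ * V.b₄ * (tateCurve q).c₆ =
      -(216 * V.b₆) + B * V.c₆ + (-(A * V.b₂ * V.c₄) + 12 * V.b₂ * V.b₄ * A) := by
    rw [hAdef, hBdef, hc4b, hc6b]; ring
  rw [e2]
  have h12n : ‖(12 : ℚ_[3])‖ ≤ 1 := by
    have h : ((12 : ℤ) : ℚ_[3]) = 12 := by norm_cast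
    rw [← h]; exact Padic.norm_int_le_one 12
  refine (norm_add_le_max _ _).trans (max_le ((norm_add_le_max _ _).trans (max_le ?_ ?_))
    ((norm_add_le_max _ _).trans (max_le ?_ ?_)))
  · rw [norm_neg, norm_mul]
    calc ‖(216 : ℚ_[3])‖ * ‖V.b₆‖ ≤ (1 / 27) * 1 := by gcongr
      _ ≤ 1 / 9 := by norm_num
  · rw [norm_mul]
    calc ‖B‖ * ‖V.c₆‖ ≤ (1 / 9) * 1 := by gcongr; exact hc6W.le
      _ = 1 / 9 := mul_one _
  · rw [norm_neg, norm_mul, norm_mul]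
    calc ‖A‖ * ‖V.b₂‖ * ‖V.c₄‖ ≤ (1 / 27) * 1 * 1 := by gcongr; exact hc4W.le
      _ ≤ 1 / 9 := by norm_num
  · rw [norm_mul, norm_mul, norm_mul]
    calc ‖(12 : ℚ_[3])‖ * ‖V.b₂‖ * ‖V.b₄‖ * ‖A‖ ≤ 1 * 1 * 1 * (1 / 27) := by gcongr
      _ ≤ 1 / 9 := by norm_num

/-- **`κ ≡ −b₂b₄/c₄ (mod 3)`**: the `z²`-coefficient `κ = (C⁻² − b₂)/12` of `x·Σ²_E(P)` satisfies
`‖(C⁻² − b₂)/12 + b₂b₄/c₄‖₃ ≤ 3⁻¹` (`‖1/12‖₃ = 3` times the second-order table). This is the digit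
the second-order numerator law reads. [cite: SilvermanATAEC1994, Thm. V.3.1 (b)] -/
theorem norm_kappa_add_le [W.IsElliptic] [W.IsGloballyMinimal] (hW : Mult W 3) {q : ℚ_[3]} (hq : ‖q‖ < 1) :
    ‖((uniformisationScaleSq W 3 q)⁻¹ - (W.baseChange ℚ_[3]).b₂) / 12 +
        (W.baseChange ℚ_[3]).b₂ * (W.baseChange ℚ_[3]).b₄ / (W.baseChange ℚ_[3]).c₄‖ ≤ 1 / 3 := by
  set V := W.baseChange ℚ_[3]
  have h12 : (12 : ℚ_[3]) ≠ 0 := by norm_num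
  have h12i : ‖(12 : ℚ_[3])⁻¹‖ = 3 := by
    rw [show (12 : ℚ_[3]) = ((4 : ℤ) : ℚ_[3]) * 3 by norm_num, mul_inv, norm_mul, norm_inv, norm_inv,
      Padic.norm_intCast_eq_one_iff.mpr (by norm_num), inv_one, one_mul,
      show (3 : ℚ_[3]) = ((3 : ℕ) : ℚ_[3]) by norm_cast, Padic.norm_p]; norm_num
  have e : ((uniformisationScaleSq W 3 q)⁻¹ - V.b₂) / 12 + V.b₂ * V.b₄ / V.c₄ =
      (12 : ℚ_[3])⁻¹ * ((uniformisationScaleSq W 3 q)⁻¹ - V.b₂ + 12 * V.b₂ * V.b₄ / V.c₄) := by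
    field_simp
  rw [e, norm_mul, h12i]
  calc 3 * ‖(uniformisationScaleSq W 3 q)⁻¹ - V.b₂ + 12 * V.b₂ * V.b₄ / V.c₄‖ ≤ 3 * (1 / 9) := by
        gcongr; exact norm_inv_scaleSq_sub_b₂_add_le hW hq
    _ = 1 / 3 := by norm_num

/-- `‖b₂b₄/c₄‖₃ ≤ 1` at a multiplicative `3`. [folklore] -/
theorem norm_b₂_mul_b₄_div_c₄_le [W.IsElliptic] [W.IsGloballyMinimal] (hW : Mult W 3) :
    ‖(W.baseChange ℚ_[3]).b₂ * (W.baseChange ℚ_[3]).b₄ / (W.baseChange ℚ_[3]).c₄‖ ≤ 1 := by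
  obtain ⟨hb2, hb4, -⟩ := norm_b_le_one' (W := W)
  obtain ⟨hc4W, -⟩ := norm_c₄_c₆_baseChange_eq_one (W := W) hW
  rw [norm_div, norm_mul, hc4W, div_one]
  calc ‖(W.baseChange ℚ_[3]).b₂‖ * ‖(W.baseChange ℚ_[3]).b₄‖ ≤ 1 * 1 := by gcongr
    _ = 1 := one_mul _

end Scale

end Summit.BirchSwinnertonDyer.Rank1Residual.X11b.RegMult.HeightLogNumerator

end
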